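import Summits.KontsevichZagierPeriods.KontsevichZagierPeriods.Theses.ScissorsAvatars
import Summits.KontsevichZagierPeriods.KontsevichZagierPeriods.Theorems.ScissorsAvatarsDivisibilityScissors
import Literature.NumberTheory.Transcendental.MZVSimplexRepProofs

/-!
# `MzvScissorsSector` (stmt-KontsevichZagierPeriods-4259, route ScissorsAvatars) — the split glue

The sector node `MzvScissorsSector` of route ScissorsAvatars (for every weight `w`, every vanishing
`ℤ`-combination `c` of the weight-`w` Kontsevich simplex representations `[mzvRep s]` lies in the
Newton–Leibniz-free "scissors" sub-calculus `C₁₂ = closure (domainAddRel ∪ integrandAddRel ∪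
changeOfVariablesRel)`) follows from TWO pieces, one structural and transcendence-free, one the
shared transcendence wall:

* `HoffmanScissorsSpan` — HOFFMAN NORMAL FORM INSIDE `C₁₂`: every `c` in the subgroup generated by
  the weight-`w` simplex representations has `N > 0` and an `h` in the subgroup generated by the
  weight-`w` HOFFMAN simplex representations (`u ∈ {2,3}^×`) with `N • c − h ∈ C₁₂`;
* `HoffmanIndependence` — the real Hoffman values `ζ(u)`, `u ∈ {2,3}^×`, are `ℚ`-linearly independent
  (verbatim route LinRedNormalForm's item stmt-KontsevichZagierPeriods-15045 and
  `MzvKernelInKZ.TwoPosets.HoffmanIndependent`; with Brown's theorem it is Zagier's conjecture).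

`MzvScissorsSector_of_subs : HoffmanScissorsSpan → HoffmanIndependence → MzvScissorsSector`
(both hypotheses spelled out as `Prop`s, so that a route split can cite this theorem by name).
Proof: `N • c − h ∈ C₁₂ ⊆ relations ⊆ ker eval` (soundness), so `eval h = 0`; a coordinate /
realisation pair `coord` / `realise` on the free abelian group turns `ℚ`-linear independence of the
values into "`h = 0` in `FormalRep`" (coordinates are CHOSEN Hoffman indices, so no injectivity of
`u ↦ mzvRep u` is needed); then `N • c ∈ C₁₂` and integer division in `C₁₂` is the landed item
`DivisibilityScissors` (`ScissorsAvatars.divisibilityScissors_proof`).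

Sources: M. Kontsevich, D. Zagier, *Periods* (2001), §1.1–1.2; F. Brown, *Mixed Tate motives over ℤ*,
Ann. of Math. 175 (2012), Thm 1.1; D. Zagier, ECM 1992 (1994), §9.
-/

noncomputable section

namespace Summit.KontsevichZagierPeriods.ScissorsAvatars.MzvScissorsSectorSplit

open Literature.NumberTheory.Transcendental
open Summit.KontsevichZagierPeriods.KontsevichZagierPeriods.Theses.ScissorsAvatars (MzvScissorsSector)

/-! ## Coordinates on the Hoffman span -/

/-- Hoffman indices `u ∈ {2,3}^×`. [folklore] -/
abbrev HIdx : Type := {u : List ℕ // MZV.IsHoffman u}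

/-- The simplex-representation generator `[mzvRep u] ∈ FormalRep` of a Hoffman index.
[cite: KontsevichZagier2001, §1.1] -/
def ofH (u : HIdx) : KZ.FormalRep :=
  KZ.of (KZ.mzvRep u.1 u.2.isAdmissible (KZ.mzvIntegrand_isSemialgebraicFunOn_holds u.1)
    (KZ.mzvIntegrand_integrableOn_holds u.1 u.2.isAdmissible))

open scoped Classical in
/-- Coordinates `FormalRep →+ (HIdx →₀ ℤ)`: a generator which IS a Hoffman generator `ofH u` goes to
`single u 1` for a CHOSEN such `u`, every other generator to `0`. [folklore] -/
def coord : KZ.FormalRep →+ (HIdx →₀ ℤ) :=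
  FreeAbelianGroup.lift fun p =>
    if h : ∃ u : HIdx, FreeAbelianGroup.of p = ofH u then Finsupp.single h.choose 1 else 0

/-- Realisation `(HIdx →₀ ℤ) →+ FormalRep`, `f ↦ Σ_u f u • [mzvRep u]`. [folklore] -/
def realise : (HIdx →₀ ℤ) →+ KZ.FormalRep :=
  Finsupp.liftAddHom fun u => zmultiplesHom KZ.FormalRep (ofH u)

/-- `realise (single u n) = n • [mzvRep u]`. [folklore] -/
theorem realise_single (u : HIdx) (n : ℤ) : realise (Finsupp.single u n) = n • ofH u := by
  simp [realise]

/-- On a Hoffman generator, `realise ∘ coord` is the identity. [folklore] -/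
theorem realise_coord_ofH (u : HIdx) : realise (coord (ofH u)) = ofH u := by
  have hex : ∃ v : HIdx, ofH u = ofH v := ⟨u, rfl⟩
  have hc : coord (ofH u) = Finsupp.single hex.choose 1 := by
    show FreeAbelianGroup.lift _ (FreeAbelianGroup.of _) = _
    rw [FreeAbelianGroup.lift_apply_of]
    exact dif_pos hex
  rw [hc, realise_single, one_zsmul]
  exact hex.choose_spec.symm

/-- On the subgroup generated by the weight-`w` Hoffman simplex representations, `realise ∘ coord` is
the identity. [folklore] -/
theorem realise_coord_eq {w : ℕ} {h : KZ.FormalRep}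
    (hh : h ∈ AddSubgroup.closure {x : KZ.FormalRep | ∃ (s : List ℕ) (hs : MZV.IsAdmissible s),
      MZV.IsHoffman s ∧ MZV.weight s = w ∧ x = KZ.of (KZ.mzvRep s hs
        (KZ.mzvIntegrand_isSemialgebraicFunOn_holds s) (KZ.mzvIntegrand_integrableOn_holds s hs))}) :
    realise (coord h) = h := by
  refine AddSubgroup.closure_induction (fun x hx => ?_) ?_ (fun x y _ _ hx hy => ?_)
    (fun x _ hx => ?_) hh
  · obtain ⟨s, hs, hH, -, rfl⟩ := hx
    exact realise_coord_ofH ⟨s, hH⟩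
  · simp
  · rw [map_add, map_add, hx, hy]
  · rw [map_neg, map_neg, hx]

/-- Evaluation of a realised coordinate vector, by Kontsevich's formula `KZ.mzvRep_value_holds`:
`eval (Σ f u • [mzvRep u]) = Σ f u • ζ(u)`. [cite: KontsevichZagier2001, §1.1] -/
theorem eval_realise (f : HIdx →₀ ℤ) :
    KZ.eval (realise f) = f.sum fun u n => n • multipleZeta u.1 := by
  rw [realise, Finsupp.liftAddHom_apply, map_finsuppSum]
  refine Finsupp.sum_congr fun u _ => ?_
  rw [zmultiplesHom_apply, map_zsmul, ofH, KZ.eval_of, KZ.mzvRep_value_holds]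

/-- **Hoffman independence in `FormalRep` terms**: under `ℚ`-linear independence of the real Hoffman
values, an `h` in the subgroup generated by the weight-`w` Hoffman simplex representations with
`KZ.eval h = 0` is `0`. [cite: Brown2012, Thm 1.1] -/
theorem hoffSpan_eq_zero_of_eval_eq_zero
    (hI : LinearIndependent ℚ (fun u : {u : List ℕ // MZV.IsHoffman u} => multipleZeta u.1))
    {w : ℕ} {h : KZ.FormalRep}
    (hh : h ∈ AddSubgroup.closure {x : KZ.FormalRep | ∃ (s : List ℕ) (hs : MZV.IsAdmissible s),
      MZV.IsHoffman s ∧ MZV.weight s = w ∧ x = KZ.of (KZ.mzvRep s hs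
        (KZ.mzvIntegrand_isSemialgebraicFunOn_holds s) (KZ.mzvIntegrand_integrableOn_holds s hs))})
    (h0 : KZ.eval h = 0) : h = 0 := by
  set f : HIdx →₀ ℤ := coord h with hf
  have hreal : realise f = h := realise_coord_eq hh
  set l : HIdx →₀ ℚ := Finsupp.mapRange (Int.cast : ℤ → ℚ) (by simp) f with hl
  have hcomb : Finsupp.linearCombination ℚ
      (fun u : {u : List ℕ // MZV.IsHoffman u} => multipleZeta u.1) l = 0 := by
    rw [Finsupp.linearCombination_apply, hl,
      Finsupp.sum_mapRange_index (h := fun (i : HIdx) (a : ℚ) => a • multipleZeta i.1)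
        (fun _ => zero_smul _ _)]
    have : (f.sum fun u (n : ℤ) => (n : ℚ) • multipleZeta u.1) = f.sum fun u n => n • multipleZeta u.1 :=
      Finsupp.sum_congr fun u _ => Int.cast_smul_eq_zsmul ℚ _ _
    rw [this, ← eval_realise, hreal, h0]
  have hl0 : l = 0 := linearIndependent_iff.mp hI l hcomb
  have hf0 : f = 0 := by
    have hinj := Finsupp.mapRange_injective (Int.cast : ℤ → ℚ) (by simp) Int.cast_injective
      (α := HIdx)
    apply hinj
    rw [← hl, hl0, Finsupp.mapRange_zero]
  rw [← hreal, hf0, map_zero]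

/-! ## The split glue -/

/-- **`MzvScissorsSector` from its two split pieces** — HOFFMAN NORMAL FORM INSIDE `C₁₂`
(`HoffmanScissorsSpan`: `∀ w, ∀ c ∈ Span_w, ∃ N > 0, ∃ h ∈ HoffSpan_w, N • c − h ∈ C₁₂`) and HOFFMAN
INDEPENDENCE (`LinearIndependent ℚ (u : {u // IsHoffman u}) ↦ ζ(u)`, item 15045's statement):
given `c ∈ Span_w` with `eval c = 0`, `N • c − h ∈ C₁₂ ⊆ relations ⊆ ker eval`
(`KZ.relations_le_ker_eval_holds`) gives `eval h = 0`, hence `h = 0`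
(`hoffSpan_eq_zero_of_eval_eq_zero`), hence `N • c ∈ C₁₂`, hence `c ∈ C₁₂` by the landed item
`DivisibilityScissors` (`ScissorsAvatars.divisibilityScissors_proof`). [folklore] -/
theorem MzvScissorsSector_of_subs :
    (∀ (w : ℕ) (c : Literature.NumberTheory.Transcendental.KZ.FormalRep), c ∈ AddSubgroup.closure {x : Literature.NumberTheory.Transcendental.KZ.FormalRep | ∃ (s : List ℕ) (hs : Literature.NumberTheory.Transcendental.MZV.IsAdmissible s), Literature.NumberTheory.Transcendental.MZV.weight s = w ∧ x = Literature.NumberTheory.Transcendental.KZ.of (Literature.NumberTheory.Transcendental.KZ.mzvRep s hs (Literature.NumberTheory.Transcendental.KZ.mzvIntegrand_isSemialgebraicFunOn_holds s) (Literature.NumberTheory.Transcendental.KZ.mzvIntegrand_integrableOn_holds s hs))} → ∃ (N : ℕ) (h : Literature.NumberTheory.Transcendental.KZ.FormalRep), 0 < N ∧ h ∈ AddSubgroup.closure {x : Literature.NumberTheory.Transcendental.KZ.FormalRep | ∃ (s : List ℕ) (hs : Literature.NumberTheory.Transcendental.MZV.IsAdmissible s), Literature.NumberTheory.Transcendental.MZV.IsHoffman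 s ∧ Literature.NumberTheory.Transcendental.MZV.weight s = w ∧ x = Literature.NumberTheory.Transcendental.KZ.of (Literature.NumberTheory.Transcendental.KZ.mzvRep s hs (Literature.NumberTheory.Transcendental.KZ.mzvIntegrand_isSemialgebraicFunOn_holds s) (Literature.NumberTheory.Transcendental.KZ.mzvIntegrand_integrableOn_holds s hs))} ∧ N • c - h ∈ AddSubgroup.closure (Literature.NumberTheory.Transcendental.KZ.domainAddRel ∪ Literature.NumberTheory.Transcendental.KZ.integrandAddRel ∪ Literature.NumberTheory.Transcendental.KZ.changeOfVariablesRel)) →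
    LinearIndependent ℚ (fun u : {u : List ℕ // Literature.NumberTheory.Transcendental.MZV.IsHoffman u} => Literature.NumberTheory.Transcendental.multipleZeta u.1) →
    MzvScissorsSector := by
  intro hS hI w c hc hc0
  obtain ⟨N, h, hN, hh, h12⟩ := hS w c hc
  have hrel : N • c - h ∈ KZ.relations := AddSubgroup.closure_mono Set.subset_union_left h12
  have hker : KZ.eval (N • c - h) = 0 := AddMonoidHom.mem_ker.1 (KZ.relations_le_ker_eval_holds hrel)
  have hh0 : KZ.eval h = 0 := by
    rw [map_sub, map_nsmul, hc0, smul_zero, zero_sub, neg_eq_zero] at hker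
    exact hker
  have h0 : h = 0 := hoffSpan_eq_zero_of_eval_eq_zero hI hh hh0
  rw [h0, sub_zero] at h12
  exact Summit.KontsevichZagierPeriods.ScissorsAvatars.divisibilityScissors_proof c N hN h12

/-- The birth line's `FormalRep`-level independence stub follows from item 15045's statement.
[cite: Brown2012, Thm 1.1] -/
theorem hoffSpan_independent_of_linearIndependent
    (hI : LinearIndependent ℚ (fun u : {u : List ℕ // MZV.IsHoffman u} => multipleZeta u.1)) :
    ∀ (w : ℕ) (h : KZ.FormalRep), h ∈ AddSubgroup.closure {x : KZ.FormalRep | ∃ (s : List ℕ) (hs : MZV.IsAdmissible s), MZV.IsHoffman s ∧ MZV.weight s = w ∧ x = KZ.of (KZ.mzvRep s hs (KZ.mzvIntegrand_isSemialgebraicFunOn_holds s) (KZ.mzvIntegrand_integrableOn_holds s hs))} → KZ.eval h = 0 → h = 0 :=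
  fun _ _ hh h0 => hoffSpan_eq_zero_of_eval_eq_zero hI hh h0

end Summit.KontsevichZagierPeriods.ScissorsAvatars.MzvScissorsSectorSplit
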